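import Summits.NavierStokesRegularity.NavierStokesRegularity.Theorems.LinearLiouvilleSeven.Negative.NormalForm

/-!
# `LinearLiouvilleSeven` fails at every nonzero element of `A_C` admitting the Galilean modes
# (negative lemma modulo `H = GalileanNontrivial`; cdisprove seat, crux stmt-NavierStokesRegularity-4054)

The line galilean-collapse (Part B) of the crux is `LL7 ∧ GaugeBounds ⇒ X`. This file proves its
contrapositive with everything but the analytic input discharged:
`linearLiouvilleSeven_false_of_galileanNontrivial : GalileanNontrivial → ¬ LinearLiouvilleSeven`,
where `GalileanNontrivial` says that some `A_C` has an element `u`, nonzero somewhere on `t < 0`,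
which ADMITS the modulated Galilean Jacobi fields `v_{φ,e} = φ′ e − φ ∂ₑu` as tempered classical
linearised solutions (`GalileanAdmissible u`; true for every element of `A_C` by KNSS 2009 Prop. 4.1
and the Galilean Jacobi identity — known, not yet formalised). Given that regularity, `H ⟺ ¬X`
(a nonzero Type-I ancient mild solution), which is OPEN: `H` is not constructible here, and the crux
stays open; but its failure set inside `A_C` is pinned to `A_C ∖ {0}`.

Proof: the seven modulations `φ_k = (1 − t)^{−(k+1)}` are admissible (`phiMod_isModulation`); the
crux applied (per direction `e_j`) to the seven modes gives `c ≠ 0` with `Σ cₖ v_{φ_k,e_j}`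
slice-constant, which freezes `∂_j u(t,·)` wherever the total modulation `Σ cₖφ_k = P_c(g)`,
`P_c ≠ 0`, is nonzero — at all but finitely many times (`finite_zeroSet`); frozen partials and the
Type-I bound make those slices constant (`slice_const_of_frozen`); the Oseen integral equation with
slices constant off a null set of times gives `u(t, x) = u(s, 0)` for good `s < t`
(`mild_eq_const`: heat kernel of mass one, odd Oseen kernel — tree `KNSSRemark61`); and the Type-I
decay `‖u(s,0)‖ ≤ C/√(−s) → 0` as `s → −∞` forces `u(t₀, x₀) = 0`, contradiction.

## References

* G. Koch, N. Nadirashvili, G. Seregin, V. Šverák, Acta Math. 203 (2009), §1 (parasitic solutions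
  `b(t)`, `−b′(t)·x`), (1.4), Prop. 4.1, Remark 6.1. [KNSS2009]
* C. R. Doering, J. D. Gibbon, *Applied Analysis of the Navier–Stokes Equations*, CUP 1995, §9.3
  (9.3.2) (the linearised system). [DoeringGibbon1995]
* Cruxes/LinearLiouvilleSeven/Lines/galilean-collapse.md, Ideator1Derivations.md §A (the Galilean
  Jacobi identity), TRIAGE-r1-1.md §A.
-/

noncomputable section

open Set Function MeasureTheory InnerProductSpace
open scoped Laplacian ContDiff Topology RealInnerProductSpace BigOperators

set_option linter.dupNamespace false

namespace Summit.NavierStokesRegularity.NavierStokesRegularity.Theorems.LinearLiouvilleSeven.Negative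

open Literature.Analysis Literature.Analysis.FluidPDE
open Summit.NavierStokesRegularity.NavierStokesRegularity.Theses.SymmetryModuliCount

section Galilean

/-- Admissible modulations: smooth on `(−∞,0)` with `|φ|, √(−t)|φ′|, √(−t)³|φ″| ≤ M`. -/
def IsModulation (φ : ℝ → ℝ) : Prop :=
  ContDiffOn ℝ (⊤ : ℕ∞) φ (Set.Iio 0) ∧ ∃ M : ℝ, ∀ t < 0,
    |φ t| ≤ M ∧ Real.sqrt (-t) * |deriv φ t| ≤ M ∧ Real.sqrt (-t) ^ 3 * |deriv (deriv φ) t| ≤ M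

/-- The modulated Galilean Jacobi field `v_{φ,e}(t,x) = φ′(t) e − φ(t) ∂ₑu(t,x)`. -/
def galMode (u : ℝ → E3 → E3) (e : E3) (φ : ℝ → ℝ) : ℝ → E3 → E3 :=
  fun t x => deriv φ t • e - φ t • fderiv ℝ (u t) x e

/-- `u` ADMITS THE GALILEAN MODES: every modulated Galilean Jacobi field about `u` is a tempered
classical solution of the linearised system for some pressure (namely `q = −φ″⟪e,x⟫ − φ ∂ₑp`).
TRUE for every `u ∈ A_C` by the KNSS gauge bounds `|∇u| ≤ C₁/(−t)`, `|∇p| ≤ C₃(−t)^{−3/2}`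
(KNSS 2009 Prop. 4.1) and the Galilean Jacobi identity (line galilean-collapse; triage r1-1 §A.1);
known, not yet formalised in the tree. [cite: KNSS2009, Prop. 4.1] -/
def GalileanAdmissible (u : ℝ → E3 → E3) : Prop :=
  ∀ (e : E3) (φ : ℝ → ℝ), IsModulation φ →
    ∃ q : ℝ → E3 → ℝ, IsTemperedLinearisedNSSolution u (galMode u e φ) q

/-- **H.** Some `A_C` has an element, nonzero somewhere on `t < 0`, admitting the Galilean modes.
Given KNSS regularity this is `¬ X` (a nonzero Type-I ancient mild solution) — OPEN, hence not
constructible here. -/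
def GalileanNontrivial : Prop :=
  ∃ (C : ℝ) (u : ℝ → E3 → E3), InClassA C u ∧ GalileanAdmissible u ∧ ∃ t < 0, ∃ x, u t x ≠ 0

/-- `g(t) = (1 − t)⁻¹ ∈ (0, 1]` for `t < 0`; `g′ = g²`. -/
def gmod (t : ℝ) : ℝ := (1 - t)⁻¹

/-- `φ_k = g^{k+1}`, `k = 0, …, 6`. -/
def phiMod (k : Fin 7) (t : ℝ) : ℝ := gmod t ^ (k.val + 1)

/-- `0 < g(t)` for `t < 0`. -/
theorem gmod_pos {t : ℝ} (ht : t < 0) : 0 < gmod t := inv_pos.2 (by linarith)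

/-- `g(t) ≤ 1` for `t < 0`. -/
theorem gmod_le_one {t : ℝ} (ht : t < 0) : gmod t ≤ 1 := inv_le_one_of_one_le₀ (by linarith)

/-- `√(−t) g(t) ≤ 1` (i.e. `√(−t) ≤ 1 − t`). -/
theorem sqrt_mul_gmod_le_one {t : ℝ} (ht : t < 0) : Real.sqrt (-t) * gmod t ≤ 1 := by
  have h1 : 0 < 1 - t := by linarith
  have hs : Real.sqrt (-t) ≤ 1 - t := by
    have h2 : Real.sqrt (-t) ^ 2 = -t := Real.sq_sqrt (by linarith)
    nlinarith [sq_nonneg (Real.sqrt (-t) - 1 / 2), Real.sqrt_nonneg (-t)]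
  unfold gmod
  rw [← div_eq_mul_inv, div_le_one h1]
  exact hs

/-- `g′ = g²`. -/
theorem hasDerivAt_gmod {t : ℝ} (ht : t < 0) : HasDerivAt gmod (gmod t ^ 2) t :=
  hasDerivAt_inv_sub (a := 1) (by linarith)

/-- `φ_k′ = (k+1) g^{k+2}`. -/
theorem hasDerivAt_phiMod (k : Fin 7) {t : ℝ} (ht : t < 0) :
    HasDerivAt (phiMod k) ((k.val + 1 : ℝ) * gmod t ^ (k.val + 2)) t := by
  have h : HasDerivAt (phiMod k) (↑(k.val + 1) * gmod t ^ (k.val + 1 - 1) * gmod t ^ 2) t :=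
    (hasDerivAt_gmod ht).pow (k.val + 1)
  refine h.congr_deriv ?_
  rw [Nat.add_sub_cancel]
  push_cast
  ring

/-- `φ_k′ = (k+1) g^{k+2}` (as `deriv`). -/
theorem deriv_phiMod {k : Fin 7} {t : ℝ} (ht : t < 0) :
    deriv (phiMod k) t = (k.val + 1 : ℝ) * gmod t ^ (k.val + 2) :=
  (hasDerivAt_phiMod k ht).deriv

/-- `φ_k″ = (k+1)(k+2) g^{k+3}`. -/
theorem hasDerivAt_deriv_phiMod (k : Fin 7) {t : ℝ} (ht : t < 0) :
    HasDerivAt (deriv (phiMod k)) ((k.val + 1 : ℝ) * (k.val + 2) * gmod t ^ (k.val + 3)) t := by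
  have h1 : HasDerivAt (fun s => (k.val + 1 : ℝ) * gmod s ^ (k.val + 2))
      ((k.val + 1 : ℝ) * (↑(k.val + 2) * gmod t ^ (k.val + 2 - 1) * gmod t ^ 2)) t :=
    ((hasDerivAt_gmod ht).pow (k.val + 2)).const_mul _
  have h2 : deriv (phiMod k) =ᶠ[𝓝 t] fun s => (k.val + 1 : ℝ) * gmod s ^ (k.val + 2) :=
    Filter.eventuallyEq_of_mem (Iio_mem_nhds ht) fun s hs => deriv_phiMod hs
  refine (h1.congr_of_eventuallyEq h2).congr_deriv ?_
  rw [show k.val + 2 - 1 = k.val + 1 from rfl]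
  push_cast
  ring

/-- `φ_k″ = (k+1)(k+2) g^{k+3}` (as `deriv ∘ deriv`). -/
theorem deriv_deriv_phiMod {k : Fin 7} {t : ℝ} (ht : t < 0) :
    deriv (deriv (phiMod k)) t = (k.val + 1 : ℝ) * (k.val + 2) * gmod t ^ (k.val + 3) :=
  (hasDerivAt_deriv_phiMod k ht).deriv

/-- **The seven modulations are admissible** (`M = (k+1)(k+2)`). -/
theorem phiMod_isModulation (k : Fin 7) : IsModulation (phiMod k) := by
  refine ⟨?_, ⟨(k.val + 1 : ℝ) * (k.val + 2), fun t ht => ⟨?_, ?_, ?_⟩⟩⟩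
  · have h1 : ContDiffOn ℝ (⊤ : ℕ∞) (fun t : ℝ => (1 - t)⁻¹) (Set.Iio 0) := by
      refine (contDiffOn_const.sub contDiffOn_id).inv ?_
      intro t ht
      simp only [Set.mem_Iio] at ht
      show (1 : ℝ) - t ≠ 0
      linarith
    exact h1.pow _
  · have hg0 := gmod_pos ht
    have hg1 := gmod_le_one ht
    have hk : (0 : ℝ) ≤ k.val := Nat.cast_nonneg _
    rw [phiMod, abs_of_pos (pow_pos hg0 _)]
    calc gmod t ^ (k.val + 1) ≤ 1 := pow_le_one₀ hg0.le hg1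
      _ ≤ (k.val + 1 : ℝ) * (k.val + 2) := by nlinarith
  · have hg0 := gmod_pos ht
    have hg1 := gmod_le_one ht
    have hsg := sqrt_mul_gmod_le_one ht
    have hk : (0 : ℝ) ≤ k.val := Nat.cast_nonneg _
    have hs0 : 0 ≤ Real.sqrt (-t) := Real.sqrt_nonneg _
    rw [deriv_phiMod ht, abs_of_pos (by positivity)]
    have e : Real.sqrt (-t) * ((k.val + 1 : ℝ) * gmod t ^ (k.val + 2)) =
        (k.val + 1 : ℝ) * ((Real.sqrt (-t) * gmod t) * gmod t ^ (k.val + 1)) := by ring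
    rw [e]
    have h1 : (Real.sqrt (-t) * gmod t) * gmod t ^ (k.val + 1) ≤ 1 := by
      calc (Real.sqrt (-t) * gmod t) * gmod t ^ (k.val + 1) ≤ 1 * 1 := by
            apply mul_le_mul hsg (pow_le_one₀ hg0.le hg1) (by positivity) zero_le_one
        _ = 1 := one_mul _
    calc (k.val + 1 : ℝ) * ((Real.sqrt (-t) * gmod t) * gmod t ^ (k.val + 1))
        ≤ (k.val + 1 : ℝ) * 1 := by apply mul_le_mul_of_nonneg_left h1; positivity
      _ ≤ (k.val + 1 : ℝ) * (k.val + 2) := by nlinarith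
  · have hg0 := gmod_pos ht
    have hg1 := gmod_le_one ht
    have hsg := sqrt_mul_gmod_le_one ht
    have hk : (0 : ℝ) ≤ k.val := Nat.cast_nonneg _
    have hs0 : 0 ≤ Real.sqrt (-t) := Real.sqrt_nonneg _
    rw [deriv_deriv_phiMod ht, abs_of_pos (by positivity)]
    have e : Real.sqrt (-t) ^ 3 * ((k.val + 1 : ℝ) * (k.val + 2) * gmod t ^ (k.val + 3)) =
        (k.val + 1 : ℝ) * (k.val + 2) * ((Real.sqrt (-t) * gmod t) ^ 3 * gmod t ^ k.val) := by
      ring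
    rw [e]
    have h1 : (Real.sqrt (-t) * gmod t) ^ 3 * gmod t ^ k.val ≤ 1 := by
      calc (Real.sqrt (-t) * gmod t) ^ 3 * gmod t ^ k.val ≤ 1 * 1 := by
            apply mul_le_mul (pow_le_one₀ (by positivity) hsg) (pow_le_one₀ hg0.le hg1)
              (by positivity) zero_le_one
        _ = 1 := one_mul _
    calc (k.val + 1 : ℝ) * (k.val + 2) * ((Real.sqrt (-t) * gmod t) ^ 3 * gmod t ^ k.val)
        ≤ (k.val + 1 : ℝ) * (k.val + 2) * 1 := by
          apply mul_le_mul_of_nonneg_left h1; positivity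
      _ = (k.val + 1 : ℝ) * (k.val + 2) := mul_one _

/-- S1: a combination of Galilean modes is `(Σ cᵢφᵢ′) e − (Σ cᵢφᵢ) ∂ₑu`. -/
theorem sum_smul_galMode (u : ℝ → E3 → E3) (e : E3) (φ : Fin 7 → ℝ → ℝ) (c : Fin 7 → ℝ)
    (t : ℝ) (x : E3) :
    ∑ i, c i • galMode u e (φ i) t x =
      (∑ i, c i * deriv (φ i) t) • e - (∑ i, c i * φ i t) • fderiv ℝ (u t) x e := by
  simp only [galMode, smul_sub, smul_smul, Finset.sum_sub_distrib, Finset.sum_smul]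

/-- S2: a slice-constant combination with nonvanishing total modulation freezes `∂ₑu(t, ·)`. -/
theorem fderiv_apply_const_of_sliceConstant {u : ℝ → E3 → E3} {e : E3} {φ : Fin 7 → ℝ → ℝ}
    {c : Fin 7 → ℝ} {t : ℝ} (h : ∃ b : E3, ∀ x, ∑ i, c i • galMode u e (φ i) t x = b)
    (hΦ : ∑ i, c i * φ i t ≠ 0) (x : E3) : fderiv ℝ (u t) x e = fderiv ℝ (u t) 0 e := by
  obtain ⟨b, hb⟩ := h
  have h1 := hb x
  have h0 := hb 0
  rw [sum_smul_galMode] at h1 h0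
  have h2 : (∑ i, c i * φ i t) • fderiv ℝ (u t) 0 e = (∑ i, c i * φ i t) • fderiv ℝ (u t) x e :=
    sub_right_inj.1 (h0.trans h1.symm)
  exact ((smul_right_injective E3 hΦ) h2).symm

/-- `Σ cᵢ φᵢ = P_c(g)` with `P_c = Σ cᵢ X^{i+1}`. -/
def modPoly (c : Fin 7 → ℝ) : Polynomial ℝ :=
  ∑ i, Polynomial.C (c i) * Polynomial.X ^ (i.val + 1)

/-- The total modulation is `P_c(g)`. -/
theorem totalMod_eq_eval (c : Fin 7 → ℝ) (t : ℝ) :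
    ∑ i, c i * phiMod i t = (modPoly c).eval (gmod t) := by
  simp [modPoly, phiMod, Polynomial.eval_finsetSum]

/-- Coefficient extraction: `coeff_{j+1} P_c = c_j`. -/
theorem modPoly_coeff (c : Fin 7 → ℝ) (j : Fin 7) : (modPoly c).coeff (j.val + 1) = c j := by
  simp only [modPoly, Polynomial.finsetSum_coeff, Polynomial.coeff_C_mul, Polynomial.coeff_X_pow]
  rw [Finset.sum_eq_single j]
  · simp
  · intro i _ hij
    have hne : j.val ≠ i.val := fun h => hij (Fin.ext h.symm)
    simp [hne]
  · intro h
    exact absurd (Finset.mem_univ j) h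

/-- `P_c ≠ 0` for `c ≠ 0`. -/
theorem modPoly_ne_zero {c : Fin 7 → ℝ} (hc : c ≠ 0) : modPoly c ≠ 0 := by
  intro h
  apply hc
  funext j
  have := modPoly_coeff c j
  rw [h, Polynomial.coeff_zero] at this
  exact this.symm

/-- `g` is injective (even with the junk value at `t = 1`). -/
theorem gmod_injective : Function.Injective gmod := by
  intro a b h
  have := inv_inj.1 h
  linarith

/-- S3: the total modulation of a nontrivial combination vanishes at finitely many times. -/
theorem finite_zeroSet {c : Fin 7 → ℝ} (hc : c ≠ 0) :
    {t : ℝ | ∑ i, c i * phiMod i t = 0}.Finite := by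
  have hfin : {r : ℝ | (modPoly c).IsRoot r}.Finite :=
    Polynomial.finite_setOf_isRoot (modPoly_ne_zero hc)
  have hpre : (gmod ⁻¹' {r : ℝ | (modPoly c).IsRoot r}).Finite :=
    hfin.preimage gmod_injective.injOn
  refine hpre.subset ?_
  intro t ht
  simp only [Set.mem_setOf_eq] at ht
  simp only [Set.mem_preimage, Set.mem_setOf_eq, Polynomial.IsRoot.def, ← totalMod_eq_eval]
  exact ht

/-- A bounded differentiable field whose derivative along `e` is a constant `m` has `m = 0`. -/
theorem dirDeriv_const_eq_zero {f : E3 → E3} (hf : Differentiable ℝ f) {e m : E3}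
    (hm : ∀ x, fderiv ℝ f x e = m) {B : ℝ} (hB : ∀ x, ‖f x‖ ≤ B) : m = 0 := by
  have hline : ∀ s : ℝ, HasDerivAt (fun s : ℝ => f (s • e)) m s := by
    intro s
    have h1 : HasDerivAt (fun s : ℝ => s • e) e s := by
      simpa using (hasDerivAt_id s).smul_const e
    have h2 := (hf (s • e)).hasFDerivAt.comp_hasDerivAt s h1
    simpa [Function.comp_def, hm] using h2
  have hconst : ∀ s : ℝ, f (s • e) - s • m = f 0 := by
    intro s
    have hsub : ∀ s : ℝ, HasDerivAt (fun s : ℝ => f (s • e) - s • m) (m - (1 : ℝ) • m) s :=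
      fun s => (hline s).sub ((hasDerivAt_id' s).smul_const m)
    have hd : Differentiable ℝ (fun s : ℝ => f (s • e) - s • m) := fun s =>
      (hsub s).differentiableAt
    have hz : ∀ s, deriv (fun s : ℝ => f (s • e) - s • m) s = 0 := fun s => by
      rw [(hsub s).deriv]; simp
    have := is_const_of_deriv_eq_zero hd hz s 0
    simpa using this
  by_contra hm0
  have hmpos : 0 < ‖m‖ := norm_pos_iff.2 hm0
  have hB0 : 0 ≤ B := (norm_nonneg _).trans (hB 0)
  set s : ℝ := (2 * B + 1) / ‖m‖ with hs
  have hs0 : 0 < s := by positivity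
  have key : ‖s • m‖ ≤ 2 * B := by
    have e1 : s • m = f (s • e) - f 0 := by rw [← hconst s]; abel
    rw [e1]
    calc ‖f (s • e) - f 0‖ ≤ ‖f (s • e)‖ + ‖f 0‖ := norm_sub_le _ _
      _ ≤ B + B := add_le_add (hB _) (hB _)
      _ = 2 * B := by ring
  rw [norm_smul, Real.norm_eq_abs, abs_of_pos hs0, hs, div_mul_cancel₀ _ hmpos.ne'] at key
  linarith

/-- A linear map vanishing on the standard basis is zero. -/
theorem clm_eq_zero_of_basis (A : E3 →L[ℝ] E3)
    (h : ∀ j : Fin 3, A (EuclideanSpace.single j 1) = 0) : A = 0 := by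
  refine ContinuousLinearMap.ext fun x => ?_
  have hx := (EuclideanSpace.basisFun (Fin 3) ℝ).sum_repr x
  rw [← hx]
  simp [map_sum, h]

/-- All three partials frozen (equal to their value at `0`) and bounded slices ⇒ the slice is
constant. -/
theorem slice_const_of_frozen {f : E3 → E3} (hf : Differentiable ℝ f)
    (hm : ∀ j : Fin 3, ∀ x, fderiv ℝ f x (EuclideanSpace.single j 1) =
      fderiv ℝ f 0 (EuclideanSpace.single j 1))
    {B : ℝ} (hB : ∀ x, ‖f x‖ ≤ B) (x : E3) : f x = f 0 := by
  have hz : ∀ j : Fin 3, fderiv ℝ f 0 (EuclideanSpace.single j 1) = 0 := fun j =>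
    dirDeriv_const_eq_zero hf (hm j) hB
  have hD : ∀ y, fderiv ℝ f y = 0 := fun y =>
    clm_eq_zero_of_basis _ fun j => by rw [hm j y, hz j]
  exact is_const_of_fderiv_eq_zero hf hD x 0

/-- S6: if the slices of `u` are constant off a finite set of times, the Oseen integral equation gives `u(t, x) = u(s, 0)` (heat kernel of mass one; the Oseen kernel is odd, so its Bochner integral against constants vanishes; the Duhamel integrand vanishes a.e. in `τ`). -/
theorem mild_eq_const {u : ℝ → E3 → E3}
    (hmild : ∀ s t : ℝ, s < t → t < 0 → ∀ x, u t x = heatFlow (u s) (t - s) x -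
      ∫ τ in Set.Ioo s t, ∫ y, oseenKernel (t - τ) (x - y) (u τ y) (u τ y))
    {Z : Set ℝ} (hZ : Z.Finite) {s t : ℝ} (hst : s < t) (ht : t < 0) (hs : s ∉ Z)
    (hconst : ∀ τ, τ < 0 → τ ∉ Z → ∀ y, u τ y = u τ 0) (x : E3) : u t x = u s 0 := by
  rw [hmild s t hst ht x]
  have hσ : 0 < t - s := sub_pos.2 hst
  have hus : u s = fun _ => u s 0 := funext fun y => hconst s (hst.trans ht) hs y
  have h1 : heatFlow (u s) (t - s) x = u s 0 := by
    rw [heatFlow_of_pos _ hσ, hus, UnboundedOperators.heatExtension_const (u s 0) hσ x]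
  have h2 : ∫ τ in Set.Ioo s t, ∫ y, oseenKernel (t - τ) (x - y) (u τ y) (u τ y) = 0 := by
    refine integral_eq_zero_of_ae ?_
    have hZ0 : (volume.restrict (Set.Ioo s t)) Z = 0 := hZ.measure_zero _
    have hae1 : ∀ᵐ τ ∂(volume.restrict (Set.Ioo s t)), τ ∉ Z := compl_mem_ae_iff.2 hZ0
    have hae2 : ∀ᵐ τ ∂(volume.restrict (Set.Ioo s t)), τ ∈ Set.Ioo s t :=
      ae_restrict_mem measurableSet_Ioo
    filter_upwards [hae1, hae2] with τ hτZ hτ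
    have hcτ : (fun y => oseenKernel (t - τ) (x - y) (u τ y) (u τ y)) =
        fun y => oseenKernel (t - τ) (x - y) (u τ 0) (u τ 0) :=
      funext fun y => by rw [hconst τ (hτ.2.trans ht) hτZ y]
    simp only [Pi.zero_apply]
    rw [hcτ]
    exact integral_oseenKernel_sub_left_eq_zero _ x _ _
  rw [h1, h2, sub_zero]

/-- **Negative lemma modulo `H = GalileanNontrivial`.** `LinearLiouvilleSeven` fails about every
nonzero element of `A_C` that admits the Galilean modes; in particular (given the KNSS gauge
regularity making every element admissible) `¬ LinearLiouvilleSeven ⟺ ¬ TypeIAncientLiouville`. -/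
theorem linearLiouvilleSeven_false_of_galileanNontrivial :
    GalileanNontrivial → ¬ LinearLiouvilleSeven := by
  rintro ⟨C, u, hA, hGal, t₀, ht₀, x₀, hne⟩ hLL
  rw [linearLiouvilleSeven_iff] at hLL
  -- S1: LL7 applied, for each direction, to the seven modulated Galilean modes
  have step1 : ∀ j : Fin 3, ∃ c : Fin 7 → ℝ, c ≠ 0 ∧ ∀ t < 0, ∃ b : E3, ∀ x,
      ∑ i, c i • galMode u (EuclideanSpace.single j 1) (phiMod i) t x = b := by
    intro j
    choose q hq using
      fun i : Fin 7 => hGal (EuclideanSpace.single j 1) (phiMod i) (phiMod_isModulation i)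
    exact hLL C u hA (fun i => galMode u (EuclideanSpace.single j 1) (phiMod i)) q
      ((sevenTempered_iff u _ q).2 hq)
  choose c hc hdep using step1
  -- the finite set of bad times
  set Z : Set ℝ := ⋃ j : Fin 3, {t : ℝ | ∑ i, c j i * phiMod i t = 0} with hZdef
  have hZ : Z.Finite := Set.finite_iUnion fun j => finite_zeroSet (hc j)
  obtain ⟨hsm, -, hmild, hTI⟩ := hA
  have hdiff : ∀ t < 0, Differentiable ℝ (u t) := fun t ht =>
    ((show IsSmoothSpaceTimeOn (Set.Iio 0) u from hsm).contDiff_slice ht).differentiable (by simp)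
  -- S2–S5: off `Z` every slice of `u` is constant
  have hconst : ∀ τ, τ < 0 → τ ∉ Z → ∀ y, u τ y = u τ 0 := by
    intro τ hτ hτZ y
    have hΦ : ∀ j : Fin 3, ∑ i, c j i * phiMod i τ ≠ 0 := fun j hj =>
      hτZ (Set.mem_iUnion.2 ⟨j, hj⟩)
    have hfro : ∀ j : Fin 3, ∀ x, fderiv ℝ (u τ) x (EuclideanSpace.single j 1) =
        fderiv ℝ (u τ) 0 (EuclideanSpace.single j 1) := fun j x =>
      fderiv_apply_const_of_sliceConstant (hdep j τ hτ) (hΦ j) x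
    exact slice_const_of_frozen (hdiff τ hτ) hfro (fun x => hTI τ hτ x) y
  -- S6: `u t₀ x₀ = u s 0` for every good time `s < t₀`
  have hval : ∀ s, s < t₀ → s ∉ Z → u t₀ x₀ = u s 0 := fun s hs hsZ =>
    mild_eq_const hmild hZ hs ht₀ hsZ hconst x₀
  -- S7: Type-I decay along `s → −∞`
  apply hne
  by_contra h0
  have hpos : 0 < ‖u t₀ x₀‖ := norm_pos_iff.2 h0
  obtain ⟨L, hL⟩ := hZ.bddBelow
  set R : ℝ := (C / ‖u t₀ x₀‖) ^ 2 with hR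
  set s : ℝ := min (min t₀ L) (-R) - 1 with hsdef
  have hm1 : min (min t₀ L) (-R) ≤ t₀ := (min_le_left _ _).trans (min_le_left _ _)
  have hm2 : min (min t₀ L) (-R) ≤ L := (min_le_left _ _).trans (min_le_right _ _)
  have hm3 : min (min t₀ L) (-R) ≤ -R := min_le_right _ _
  have hs_t : s < t₀ := by linarith
  have hsZ : s ∉ Z := fun h => by have := hL h; linarith
  have hs0 : s < 0 := hs_t.trans ht₀
  have key := hval s hs_t hsZ
  have hTIs := hTI s hs0 0
  rw [← key] at hTIs
  have hRs : R + 1 ≤ -s := by linarith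
  have hR0 : 0 ≤ R := sq_nonneg _
  have hrs : 0 < Real.sqrt (-s) := Real.sqrt_pos.2 (by linarith)
  have hsqrt : |C / ‖u t₀ x₀‖| < Real.sqrt (-s) := by
    rw [← Real.sqrt_sq_eq_abs]
    exact Real.sqrt_lt_sqrt (sq_nonneg _) (by linarith)
  have hlt : C / Real.sqrt (-s) < ‖u t₀ x₀‖ := by
    rw [div_lt_iff₀ hrs]
    have h1 : C / ‖u t₀ x₀‖ < Real.sqrt (-s) := lt_of_le_of_lt (le_abs_self _) hsqrt
    rw [div_lt_iff₀ hpos] at h1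
    linarith [mul_comm (Real.sqrt (-s)) ‖u t₀ x₀‖]
  linarith

end Galilean


end Summit.NavierStokesRegularity.NavierStokesRegularity.Theorems.LinearLiouvilleSeven.Negative

end
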